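import Literature.AnabelianGeometry.EtaleTheta.Discharge.Sec3ConstantLineOfRlfZ
import Literature.AnabelianGeometry.EtaleTheta.TemperedFrobenioidToyGenuine
import HarnessLib

/-!
# [EtTh] Def. 3.6 (ii)(b), bracketed sentence: the chain fires END-TO-END at the tree's genuine-vocabulary
# tempered Frobenioid (non-vacuity of `Prop34 ∧ hcyc` over a constructed `ofRlfZ` datum)

S. Mochizuki, *The étale theta function …*, Publ. RIMS **45** (2009) [EtTh], Def. 3.6 (ii)(b) PDF p.77, Prop. 3.4
(ii) p.74 of `paper:doi-10-2977-prims-1234361159` [cite: MochizukiEtTh2009, Def 3.6 p.77].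

abc-iut cell, layer L2, seat abc-iut-w4-d008 (gen 3); proof-only (0 defs) instantiation witness for
`Discharge/Sec3ConstantLineOfRlfZ.lean` (same seat, p428972): there the bracketed sentence of Def. 3.6 (ii)(b)
(`hNZ`, binder of row C38-L05) is proved for every tempered Frobenioid over the CONSTRUCTED Def. 3.6 (i) data
`ofRlfZ dm hpf` modulo the typed `dm.Prop34` and ONE `B₀`-level binder `hcyc` (divisors of constants are the
integer powers of one log-divisor).  Here both inputs are CHECKED at a datum in the tree and the chain is run:

* `Toy.cnstCyclic_divisorMonoids` — `hcyc` holds for abc-iut-L2-t3's toy Def. 3.3 (iii) data `Toy.divisorMonoids`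
  (`Φ₀ = ℕ = ⟨𝔭⟩`, `B₀ = F₀ = ℤ`, `div₀(n) = 𝔭ⁿ`: take `d := 𝔭`), and `DivisorMonoids.cnstCyclic_of_div₀_eq_one` —
  it holds with `d := 1` whenever all constants have trivial divisor;
* `Toy.prop34_divisorMonoids` — `Prop34` for that datum over the trivial vocabularies (`F₀ = B₀`);
* **`Toy.exists_cnstFn_effective_genuineTemperedFrobenioid`** — hence `hNZ` (VERBATIM shape of row C38-L05) for
  abc-iut-w5-d164's `Toy.genuineTemperedFrobenioid R S` (the tree's tempered Frobenioid over
  `ofRlfZ Toy.divisorMonoids _` with the GENUINE realification `ℕ^rlf`, genuine [FrdI] vocabularies and a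
  Frobenioid certificate `Toy.isFrobenioid_genuineTemperedFrobenioid`) — with NO binder left.

HONEST LABEL: a consistency / instantiation witness at DEGENERATE geometry (one object, one prime); it shows the
hypothesis set {`Prop34`, `hcyc`} of `exists_cnstFn_effective_ofRlfZ` is jointly satisfiable together with a
Frobenioid-certified tempered Frobenioid over the constructed data, nothing more; nothing here bears on
[IUTchIII] Cor. 3.12; typed ≠ proved.
-/

noncomputable section

namespace Literature.AnabelianGeometry.EtaleTheta

open CategoryTheory Opposite Literature.AlgebraicGeometry.Frobenioids

universe u v w

/-- `hcyc` from DIVISOR-FREE constants: if every constant has trivial log-divisor then the divisors of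
constants are the powers of `d := 1` (the degenerate case of "`div₀(c) = v_L(c)·div(ϖ_L)`").
[cite: MochizukiEtTh2009, Prop 3.4 (ii) p.74] -/
theorem DivisorMonoids.cnstCyclic_of_div₀_eq_one {D₀ : Type u} [Category.{v} D₀] (dm : DivisorMonoids.{u, v, w} D₀)
    (h : ∀ (Y : D₀ᵒᵖ) (b : dm.B₀.obj Y), b ∈ dm.F₀ Y → dm.div₀ Y b = 1) :
    ∀ Y : D₀ᵒᵖ, ∃ d : dm.Φ₀.obj Y, ∀ b ∈ dm.F₀ Y, ∃ n : ℤ,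
      dm.div₀ Y b = Algebra.GrothendieckGroup.of d ^ n :=
  fun Y => ⟨1, fun b hb => ⟨0, by rw [h Y b hb, zpow_zero]⟩⟩

namespace Toy

/-- **`hcyc` for the toy Def. 3.3 (iii) data** `Toy.divisorMonoids` (`Φ₀ = ℕ = ⟨𝔭⟩`, `div₀(n) = 𝔭ⁿ`): the
divisor of every constant is a power of `d := 𝔭`. [cite: MochizukiEtTh2009, Prop 3.4 (ii) p.74] -/
theorem cnstCyclic_divisorMonoids :
    ∀ Y : (Discrete PUnit.{1})ᵒᵖ, ∃ d : divisorMonoids.Φ₀.obj Y, ∀ b ∈ divisorMonoids.F₀ Y, ∃ n : ℤ,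
      divisorMonoids.div₀ Y b = Algebra.GrothendieckGroup.of d ^ n :=
  fun _ => ⟨Multiplicative.ofAdd (1 : ℕ), fun b _ => ⟨Multiplicative.toAdd (show Multiplicative ℤ from b), rfl⟩⟩

/-- **Prop. 3.4 for the toy Def. 3.3 (iii) data over the trivial vocabularies** (all functions constant:
`F₀ = B₀`, so the effective-locus clauses are trivial). [cite: MochizukiEtTh2009, Prop 3.4 p.74] -/
theorem prop34_divisorMonoids : divisorMonoids.Prop34 Toy.monoidVocab Toy.catVocab where
  isPerfFactorial _ := trivial
  isNonDilating _ _ := trivial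
  isDivisorialOn := trivial
  ker_div₀_le_F₀ _ _ _ := trivial
  mem_F₀_of_div₀_mem _ _ _ _ := trivial

variable (R S : ((Discrete PUnit.{1})ᵒᵖ ⥤ CommMonCat.{0}) → Prop)

/-- **Def. 3.6 (ii)(b), bracketed sentence, END-TO-END at the tree's genuine-vocabulary tempered Frobenioid**
`Toy.genuineTemperedFrobenioid R S` (over `ofRlfZ Toy.divisorMonoids _`): the image of `F(A) → (Φ^{bs-fld})^gp(A)`
contains a nonzero element of `Φ^{bs-fld}(A)` — `exists_cnstFn_effective_ofRlfZ` with `Prop34` and `hcyc`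
CHECKED, no binder left. [cite: MochizukiEtTh2009, Def 3.6 p.77] -/
theorem exists_cnstFn_effective_genuineTemperedFrobenioid (A : (Discrete PUnit.{1})ᵒᵖ) :
    ∃ u : (realifiedGenuine.BΛ.obj ((genuineTemperedFrobenioid R S).baseOp A) : Type) ×
        Algebra.GrothendieckGroup ((genuineTemperedFrobenioid R S).Φ.carrier A),
      u ∈ (genuineTemperedFrobenioid R S).cnstFn A ∧
        ∃ Z : (genuineTemperedFrobenioid R S).Φ.carrier A, Z ≠ 1 ∧ u.2 = Algebra.GrothendieckGroup.of Z :=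
  (genuineTemperedFrobenioid R S).exists_cnstFn_effective_ofRlfZ prop34_divisorMonoids cnstCyclic_divisorMonoids A

/-- … and row C38-L05's remaining data-side binders at this datum are `Prop34 ✓`, `hcyc ✓`: the criterion
`bsFldPreStepLimitCriterion_ofRlfZ` for `Toy.genuineTemperedFrobenioid R S` (a Frobenioid:
`isFrobenioid_genuineTemperedFrobenioid`) modulo the supremum property `hSup` alone.
[cite: MochizukiEtTh2009, Cor 3.8 p.81] -/
theorem bsFldPreStepLimitCriterion_genuineTemperedFrobenioid
    (hSup : ∀ (W : Discrete PUnit.{1}) (m : Perfection ((genuineTemperedFrobenioid R S).divisorMonoid.obj (op W)))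
      (U : Set (Perfection ((genuineTemperedFrobenioid R S).divisorMonoid.obj (op W)))),
      U ⊆ (genuineTemperedFrobenioid R S).bsFldPf W → U.Nonempty → (∀ u ∈ U, u ∣ m) →
        ∃ y ∈ (genuineTemperedFrobenioid R S).bsFldPf W, (∀ u ∈ U, u ∣ y) ∧ y ∣ m) :
    (genuineTemperedFrobenioid R S).BsFldPreStepLimitCriterion
      (PreFrobenioidData.perfection (isFrobenioid_genuineTemperedFrobenioid R S)) :=
  (genuineTemperedFrobenioid R S).bsFldPreStepLimitCriterion_ofRlfZ (isFrobenioid_genuineTemperedFrobenioid R S)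
    prop34_divisorMonoids cnstCyclic_divisorMonoids hSup

end Toy

end Literature.AnabelianGeometry.EtaleTheta

end
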